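import Literature.AnabelianGeometry.EtaleTheta.TemperedFrobenioidUnitToyShift
import Literature.AnabelianGeometry.EtaleTheta.TemperedFrobenioidCor38SubSchemaNegative
import Literature.AnabelianGeometry.EtaleTheta.TemperedFrobenioidToyCuspFlip
import Literature.AnabelianGeometry.EtaleTheta.TemperedFrobenioidToyDilating
import Literature.AnabelianGeometry.EtaleTheta.Discharge.Sec3Cor38iStatementToy
import Literature.AnabelianGeometry.EtaleTheta.TemperedFrobenioidUnitToyCollapse
import HarnessLib

/-!
# [EtTh] Cor. 3.8 sub-DAG row C38-L02a `Cor38Hyp.PreservesPreSteps` (F-2809) HOLDS at every `Cor38Hyp` witness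
# record of the tree (kernel bookkeeping for the closure-side census)

S. Mochizuki, *The étale theta function and its Frobenioid-theoretic manifestations*, Publ. RIMS **45** (2009)
[EtTh], Cor. 3.8, proof, PDF p. 81 l. 2–3: "In particular, by [Mzk17], Theorem 3.4, (ii) … it follows that `Ψ`
preserves pre-steps" [cite: MochizukiEtTh2009, Cor 3.8 p.81]; S. Mochizuki, *The geometry of Frobenioids I*,
Kyushu J. Math. **62** (2008), Def. 1.2 (iii) p. 22 (pre-step = linear base-isomorphism), Thm. 3.4 (ii) p. 62
[cite: MochizukiFrdI2008, Thm. 3.4 (ii) p.62].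

PROOF-ONLY companion (0 definitions; cell abc-iut, seat abc-iut-L1-t13, FACT-LIST row **F-2809**) of
abc-iut-w5-d124's `TemperedFrobenioidCor38Sub.lean`.  The row's INSTANCE form (what print asserts) is proved in
`Discharge/Sec3Cor38RowsTreeVocabOfThm34ii.lean` (`Cor38Hyp.preservesPreSteps_treeCatVocab_of_isMonoidOn` =
`FrdI.Thm34ii_holds` at the canonical vocabulary).  Its bare universal closure (cell rule R5: ALL records
`h : Cor38Hyp C₁ C₂` over FREE vocabularies) is UNDECIDED; this file records, in the kernel, that none of the
seven degenerate witness records by which the sibling rows F-2808 / F-2813 / F-2814 / F-2816 / F-2818 / F-2821 /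
F-2823 were schema-refuted separates F-2809:

* the five two-structures-one-category records with `Ψ = 𝟭` — `TwoPrimes.hyp`, `UnitToy.hypRefl`, `CuspFlip.hyp`,
  `DilatingToy.hyp`, `Cor38ToyPair.hyp` — trivially (`(deg_Fr, Base)` of the two structures coincide on the nose);
* `DegreeTwist.hyp ε` (base `SingleObj G`, `Ψ = twist ε : (d,g,z,u) ↦ (d, g·ε(d), z, u)`): `deg_Fr` is kept and every
  base arrow of a groupoid is invertible;
* `UnitToy.hypShift` (`Ψ` = conjugation by the unit isomorphisms `(1, id, n₀, 1)`, `Ψ⁻¹ = 𝟭`): degrees are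
  multiplicative and the unit isomorphisms are linear (`UnitToy.degFr_shiftFunctor_map`); the base is the one-morphism
  category.

Reading (closure-side census, HOME memo F-2809-CLOSURE-CENSUS-L1t13g7): degenerations of `Φ` alone (units, torsion,
idempotent parts) are invisible to `(deg_Fr, Base)`; a separating model would have to move the base, which the
FSMFF/totally-epimorphic constraints appear to pin — desk verdict TRUE, residual = [FrdI] Thm. 3.4 (ii) for MODEL type
over the typed interface (not in tree).  HONEST FRAMING: bookkeeping about OUR typed interface and its toy inhabitants;
nothing here bears on [EtTh] Cor. 3.8 as printed or on [IUTchIII] Cor. 3.12; no side taken; typed ≠ proved.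

v2 (append-only): the EIGHTH witness record `UnitToy.hypCollapse` (abc-iut-f-135 g2, `TemperedFrobenioidUnitToyCollapse.lean`,
`Ψ = collapseEquiv : frdFull.category ≌ Toy.temperedFrobenioid.category`, the datum that schema-refutes F-2810) also satisfies
F-2809: `collapse` keeps `deg_Fr` on the nose (`UnitToy.degFr_collapse_map`) and both bases are the one-morphism category;
for the `Ψ⁻¹` half, degrees are transported through the counit isomorphism (isomorphisms are linear, degrees multiply).
-/

noncomputable section

namespace Literature.AnabelianGeometry.EtaleTheta

open CategoryTheory Opposite Literature.AlgebraicGeometry.Frobenioids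

/-! ### The Frobenius-degree twist over `SingleObj G` -/

namespace DegreeTwist

variable {G : Type} [CommGroup G]

/-- Row F-2809 HOLDS at `hyp ε`: the twist and its quasi-inverse keep `deg_Fr` on the nose, and every base arrow of
the groupoid `SingleObj G` is invertible. [cite: MochizukiEtTh2009, Cor 3.8 p.81] -/
theorem preservesPreSteps_hyp (ε : ℕ+ →* G) : (hyp ε).PreservesPreSteps :=
  ⟨fun _ _ φ h => ⟨h.1, show IsIso (ModelFrobenioid.baseMap ((twist ε).map φ)) from inferInstance⟩,
    fun _ _ φ h => ⟨h.1, show IsIso (ModelFrobenioid.baseMap ((twist ε⁻¹).map φ)) from inferInstance⟩⟩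

end DegreeTwist

/-! ### The unit shift of `UnitToy.frdFull` -/

namespace UnitToy

/-- Over the one-morphism base every arrow of `frdFull.category` is a base-isomorphism.
[cite: MochizukiFrdI2008, Def. 1.2 (iii) p.22] -/
theorem isBaseIso_frdFull {X Y : frdFull.category} (φ : X ⟶ Y) : frdFull.opsData.IsBaseIso φ := by
  change IsIso (ModelFrobenioid.baseMap φ)
  infer_instance

/-- `deg_Fr` of the conjugate `(1,id,n₀⁻¹,1) ≫ φ ≫ (1,id,n₀,1)` is `deg_Fr φ` ([FrdI] Thm. 5.2 (i): degrees multiply).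
[cite: MochizukiFrdI2008, Thm. 5.2(i) p.100] -/
theorem degFr_shiftFunctor_map {X Y : frdFull.category} (φ : X ⟶ Y) :
    ModelFrobenioid.degFr (shiftFunctor.map φ) = ModelFrobenioid.degFr φ := by
  change ModelFrobenioid.degFr ((shiftIso X).inv ≫ φ ≫ (shiftIso Y).hom) = _
  rw [ModelFrobenioid.degFr_comp, ModelFrobenioid.degFr_comp]
  change (1 : ℕ+) * ModelFrobenioid.degFr φ * 1 = _
  rw [mul_one, one_mul]

/-- Row F-2809 HOLDS at `hypShift`: conjugation by the unit isomorphisms keeps `deg_Fr`, the base is trivial, and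
`Ψ⁻¹ = 𝟭`. [cite: MochizukiEtTh2009, Cor 3.8 p.81] -/
theorem preservesPreSteps_hypShift : hypShift.PreservesPreSteps := by
  refine ⟨fun X Y φ h => ⟨?_, isBaseIso_frdFull _⟩, fun X Y φ h => h⟩
  change ModelFrobenioid.degFr (shiftFunctor.map φ) = 1
  rw [degFr_shiftFunctor_map]
  exact h.1

/-- Row F-2809 HOLDS at `hypRefl` (`Ψ = 𝟭` between `frdFull` and `frdNat`, one and the same category).
[cite: MochizukiEtTh2009, Cor 3.8 p.81] -/
theorem preservesPreSteps_hypRefl : hypRefl.PreservesPreSteps :=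
  ⟨fun _ _ _ h => h, fun _ _ _ h => h⟩

end UnitToy

/-! ### The `Ψ = 𝟭` records -/

/-- Row F-2809 HOLDS at `TwoPrimes.hyp` (`Ψ = 𝟭 : C 1 ⥲ C 0`). [cite: MochizukiEtTh2009, Cor 3.8 p.81] -/
theorem TwoPrimes.preservesPreSteps_hyp : TwoPrimes.hyp.PreservesPreSteps :=
  ⟨fun _ _ _ h => h, fun _ _ _ h => h⟩

/-- Row F-2809 HOLDS at `CuspFlip.hyp` (`Ψ = id`). [cite: MochizukiEtTh2009, Cor 3.8 p.81] -/
theorem CuspFlip.preservesPreSteps_hyp : CuspFlip.hyp.PreservesPreSteps :=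
  ⟨fun _ _ _ h => h, fun _ _ _ h => h⟩

/-- Row F-2809 HOLDS at `DilatingToy.hyp` (`Ψ = 𝟭`, base `SingleObj (ℚ≥0)ˣ`). [cite: MochizukiEtTh2009, Cor 3.8 p.81] -/
theorem DilatingToy.preservesPreSteps_hyp : DilatingToy.hyp.PreservesPreSteps :=
  ⟨fun _ _ _ h => h, fun _ _ _ h => h⟩

/-- Row F-2809 HOLDS at `Cor38ToyPair.hyp` (`Ψ = 𝟭`, `Discharge/Sec3Cor38iStatementToy`). [cite: MochizukiEtTh2009, Cor 3.8 p.81] -/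
theorem Cor38ToyPair.preservesPreSteps_hyp : Cor38ToyPair.hyp.PreservesPreSteps :=
  ⟨fun _ _ _ h => h, fun _ _ _ h => h⟩

/-! ### v2 — the collapse `frdFull ≌ Toy` (eighth witness record) -/

namespace UnitToy

/-- Over the one-morphism base every arrow of `Toy.temperedFrobenioid.category` is a base-isomorphism.
[cite: MochizukiFrdI2008, Def. 1.2 (iii) p.22] -/
theorem isBaseIso_toy {X Y : Toy.temperedFrobenioid.category} (φ : X ⟶ Y) :
    Toy.temperedFrobenioid.opsData.IsBaseIso φ := by
  change IsIso (ModelFrobenioid.baseMap φ)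
  infer_instance

/-- Row F-2809 HOLDS at `hypCollapse`: `collapse` keeps `deg_Fr` (`degFr_collapse_map`), both bases are the one-morphism
category, and the `Ψ⁻¹`-half follows by transporting degrees through the counit `collapse (collapse⁻¹ Y) ≅ Y`.
[cite: MochizukiEtTh2009, Cor 3.8 p.81] -/
theorem preservesPreSteps_hypCollapse : hypCollapse.PreservesPreSteps := by
  refine ⟨fun X Y φ h => ⟨?_, isBaseIso_toy _⟩, fun X Y φ h => ⟨?_, isBaseIso_frdFull _⟩⟩
  · -- `Ψ` half: `deg_Fr (collapse φ) = deg_Fr φ = 1`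
    change ModelFrobenioid.degFr (collapse.map φ) = 1
    rw [degFr_collapse_map]
    exact h.1
  · -- `Ψ⁻¹` half: apply `collapse` and use the counit naturality square
    change ModelFrobenioid.degFr (collapseEquiv.inverse.map φ) = 1
    have hnat := collapseEquiv.counit.naturality φ
    -- `collapse (collapse⁻¹ φ) ≫ ε_Y = ε_X ≫ φ`
    have hdeg := congrArg ModelFrobenioid.degFr hnat
    simp only [Functor.comp_map, Functor.id_map, ModelFrobenioid.degFr_comp] at hdeg
    have h1 : ModelFrobenioid.degFr φ = 1 := h.1
    have hεY : ModelFrobenioid.degFr (collapseEquiv.counit.app Y) = 1 := degFr_eq_one_of_isIso_toy _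
    have hεX : ModelFrobenioid.degFr (collapseEquiv.counit.app X) = 1 := degFr_eq_one_of_isIso_toy _
    rw [hεY, one_mul, h1, hεX, mul_one] at hdeg
    -- `hdeg : degFr (collapseEquiv.functor.map (inverse.map φ)) = 1`, and `collapseEquiv.functor = collapse`
    -- keeps degrees definitionally (`degFr_collapse_map` is `rfl`)
    exact hdeg
where
  /-- degrees of isomorphisms of the sharp toy are `1` -/
  degFr_eq_one_of_isIso_toy {X Y : Toy.temperedFrobenioid.category} (e : X ⟶ Y) [IsIso e] :
      ModelFrobenioid.degFr e = 1 := by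
    have h : ModelFrobenioid.degFr (e ≫ inv e) = 1 := by rw [IsIso.hom_inv_id]; rfl
    rw [ModelFrobenioid.degFr_comp] at h
    exact PNat.eq (Nat.eq_one_of_mul_eq_one_left (congrArg PNat.val h))

end UnitToy

end Literature.AnabelianGeometry.EtaleTheta
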